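import Mathlib
import HarnessLib
import HarnessLib.Audit
import Literature.NumberTheory.LFunctions.ZetaScrew
import Summits.RiemannHypothesis.RiemannHypothesis.Theorems.IntegerScrewIncrementSharp
import Summits.RiemannHypothesis.RiemannHypothesis.Theorems.IntegerScrewIncrementSecondOrder
import Summits.RiemannHypothesis.RiemannHypothesis.Theorems.IntegerScrewIncrementCovariance
import Summits.RiemannHypothesis.RiemannHypothesis.Theorems.IntegerScrewDefs
import Summits.RiemannHypothesis.RiemannHypothesis.Theorems.IntegerScrewIncrementCovLag
import Summits.RiemannHypothesis.RiemannHypothesis.Theorems.IntegerScrewHingeCarrier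
import Summits.RiemannHypothesis.RiemannHypothesis.Theorems.IntegerScrewArithmeticFloor

/-!
# Route `IntegerScrew` — TYPED LEAVES of the pivot law (SCREW column, ladder row S-P (P2); all RH-FREE)

The pivot law of HOME/pivot/PIVOT-LAW.md §10.1 reads `m·d_m = L(m) − G(m)` with
`L(M) := M·2Ψ(log(M/(M−1)))` (the increment energy of Kreĭn's screw line between consecutive
log-integer nodes) and `G ≥ 0` the deficit.  Everything RH-FREE in that law concerns `L`, the local
structure of the increments and the hinge of `Ψ` at prime powers; everything about the SIZE of `G` is
an RH-consequence (no all-`M` statement weaker than RH exists: `additiveSlack_iff_rh`).  This file names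
the RH-FREE sentences as `Prop` CONSTANTS (D-0061 «rung leaves»), each already a THEOREM of the tree
or of a staged file, and discharges the ones whose source olean is available:

* `PivotLawLeadingTerm` — `∀ M ≥ 3, |L(M) − (log M − c₀)| ≤ (log M + 19)/(M − 1)`, `c₀ = log 2π + γ − 1`
  (THEOREM `abs_incrementEnergy_sub_le`, p371654); `pivotLawLeadingTerm_holds`.
* `PivotLawThirdTerm` — `∀ M ≥ 3, |L(M) − (log M − c₀) − (log M + 5/2 − c₀)/(2M)| ≤ (2 log M + 16)/M²`
  (THEOREM `abs_incrementEnergy_sub_secondOrder_le`, p403652 `IntegerScrewIncrementSecondOrder`; the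
  `_holds` is appended here once that module's olean exists on the hub).
* `PivotIncrementCovariance` — `∀ M ≥ 6, |M·(Ψ(log(M/(M−2))) − Ψ(h_M) − Ψ(h_{M−1})) + log 2| ≤ 40/(M−2)`
  (adjacent increments: `M·Cov(I_M, I_{M−1}) → −log 2`; THEOREM in the staged
  `IntegerScrewIncrementCovariance`, `_holds` appended on landing).
* `ScrewHingeJump` — `∀ q ≥ 2, Ψ′(log q⁺) − Ψ′(log q⁻) = −Λ(q)/√q` (THEOREM
  `derivWithin_zetaScrew_Ici_sub_Iic`, p402803 `IntegerScrewHingeCarrier`; `_holds` appended once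
  its olean exists).

* `PivotDeficitArithmeticFloor K P` — `∀ ε > 0, ∀ᶠ M, S_{M−1} ≻ 0 → S_K + Σ_{q∈P} Λ(q)²/q² − ε ≤ G(M)·log M`
  (PIVOT-LAW §15.14; THEOREM `eventually_arithmetic_deficit_floor`, `IntegerScrewArithmeticFloor`);
  `pivotDeficitArithmeticFloor_holds`; with it `pivotDeficitContinuumFloor_holds` /
  `pivotDeficitTwoNodeFloor_holds` close the leaves P2-g / P2-f.

LABEL (ladder rule §5.4): RH-FREE, each a statement about the explicit function `Ψ = zetaScrew`;
nothing here bears on the truth of RH.  Reference for `Ψ`: [Suzuki2023, (1.1)].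
-/

noncomputable section

-- D-0017: `Summit.<S>.<S>.…` is the designed namespace of a single-problem summit.
set_option linter.dupNamespace false

namespace Summit.RiemannHypothesis.RiemannHypothesis.Theorems.IntegerScrew

open Literature.NumberTheory.LFunctions Set

/-- The constant `c₀ = log 2π + γ₀ − 1 = 1.41509…` of the pivot law's leading term. [folklore] -/
def pivotLawConst : ℝ := Real.log (2 * Real.pi) + Real.eulerMascheroniConstant - 1

/-- LEAF (P2-a): the sharp leading term of the pivot law, `L(M) = log M − c₀ + O(log M/M)` with the
explicit remainder `(log M + 19)/(M − 1)` for `M ≥ 3`.  RH-FREE; THEOREM (p371654) — tagged as an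
obligation node only so that it stays a Summits-side leaf; closed below by `pivotLawLeadingTerm_holds`.
[folklore] -/
@[conjecture] def PivotLawLeadingTerm : Prop :=
  ∀ M : ℕ, 3 ≤ M →
    |(M : ℝ) * (2 * zetaScrew (Real.log ((M : ℝ) / ((M : ℝ) - 1)))) - (Real.log M - pivotLawConst)|
      ≤ (Real.log M + 19) / ((M : ℝ) - 1)

/-- `PivotLawLeadingTerm` holds (`IntegerScrewIncrementSharp.abs_incrementEnergy_sub_le`).
[folklore] -/
theorem pivotLawLeadingTerm_holds : PivotLawLeadingTerm := fun M hM =>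
  abs_incrementEnergy_sub_le M hM

/-- LEAF (P2-b): the third term of the pivot law's leading part,
`L(M) = log M − c₀ + (log M + 5/2 − c₀)/(2M) + O(log M/M²)` with the explicit remainder
`(2 log M + 16)/M²` for `M ≥ 3`.  RH-FREE; THEOREM (p403652 `abs_incrementEnergy_sub_secondOrder_le`;
`_holds` to be appended when that olean is available). [folklore] -/
@[conjecture] def PivotLawThirdTerm : Prop :=
  ∀ M : ℕ, 3 ≤ M →
    |(M : ℝ) * (2 * zetaScrew (Real.log ((M : ℝ) / ((M : ℝ) - 1))))
        - (Real.log M - pivotLawConst) - (Real.log M + 5 / 2 - pivotLawConst) / (2 * (M : ℝ))|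
      ≤ (2 * Real.log M + 16) / (M : ℝ) ^ 2

/-- LEAF (P2-c): adjacent-increment covariance of the screw line,
`|M·Cov(I_M, I_{M−1}) + log 2| ≤ 40/(M − 2)` for `M ≥ 6` with
`Cov(I_M, I_{M−1}) = Ψ(log(M/(M−2))) − Ψ(log(M/(M−1))) − Ψ(log((M−1)/(M−2)))` (PIVOT-LAW §2a(iv)).
RH-FREE; THEOREM in the staged `IntegerScrewIncrementCovariance` (`_holds` appended on landing).
[folklore] -/
@[conjecture] def PivotIncrementCovariance : Prop :=
  ∀ M : ℕ, 6 ≤ M →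
    |(M : ℝ) * (zetaScrew (Real.log ((M : ℝ) / ((M : ℝ) - 2)))
        - zetaScrew (Real.log ((M : ℝ) / ((M : ℝ) - 1)))
        - zetaScrew (Real.log (((M : ℝ) - 1) / ((M : ℝ) - 2)))) + Real.log 2|
      ≤ 40 / ((M : ℝ) - 2)

/-- LEAF (P2-d): THE HINGE — the jump of `Ψ′` at `t = log q` is `−Λ(q)/√q` for every `q ≥ 2`
(one-sided derivatives within `[log q, ∞)` and `(−∞, log q]`; zero unless `q` is a prime power).
RH-FREE; THEOREM (p402803 `derivWithin_zetaScrew_Ici_sub_Iic`; `_holds` appended when its olean is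
available). [folklore] -/
@[conjecture] def ScrewHingeJump : Prop :=
  ∀ q : ℕ, 2 ≤ q →
    derivWithin zetaScrew (Ici (Real.log q)) (Real.log q)
      - derivWithin zetaScrew (Iic (Real.log q)) (Real.log q)
      = -(ArithmeticFunction.vonMangoldt q / Real.sqrt q)

/-- `PivotLawThirdTerm` holds (`IntegerScrewIncrementSecondOrder.abs_incrementEnergy_sub_secondOrder_le`,
p403652; appended once that module's olean existed). [folklore] -/
theorem pivotLawThirdTerm_holds : PivotLawThirdTerm := fun M hM =>
  abs_incrementEnergy_sub_secondOrder_le M hM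

/-- `PivotIncrementCovariance` holds (`IntegerScrewIncrementCovariance.abs_incrementCov_add_log_two_le`,
p404587; appended once that module's olean existed). [folklore] -/
theorem pivotIncrementCovariance_holds : PivotIncrementCovariance := fun M hM =>
  abs_incrementCov_add_log_two_le M hM

/-! ### The continuum floor of the deficit (PIVOT-LAW §15, pivot-theory-1 gen19; all RH-FREE)

The lag-`k` increment covariances of the screw line have the limits `M·Cov(I_M, I_{M−k}) → c_k/2`,
`c_k := −Δ²[k log k]` (THEOREM `tendsto_incrementCovLag`, p409581 `IntegerScrewIncrementCovLag`), and
the `K`-node predictors give, for `S_{M−1} ≻ 0`, the floors `G(M)·log M ≥ S_K − o(1)`,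
`S_K := Σ_{k≤K}(c_k/2)²` (PIVOT-LAW §15.3, DERIVED for every `K`; `S_1 = (log 2)²` is the two-node gain
of §2a(iv), kernel-staged as `IntegerScrewDeficitLowerBound.eventually_deficit_mul_log_ge`), with
`S_∞ = ¼Σ_{k≥1}(Δ²[k log k])² = 0.6493591 = V/2`, the Szegő continuum constant of §8.14–8.16 in closed
form.  Leaves: `PivotIncrementCovLag` (P2-e), `PivotDeficitTwoNodeFloor` (P2-f, `K = 1`),
`PivotDeficitContinuumFloor` (P2-g, every `K`); `_holds` closers are appended as the source oleans
appear.  Lower bounds on `G` point away from RH (RH ⇔ `G(M) < L(M)` for all `M`); the floor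
`S_∞/log M` is the vanishing fraction `S_∞/log² M` of `L(M)`.  Nothing here bears on the truth of RH. -/

/-- `c_k/2 := −½Δ²[k log k] = −½((k+1)log(k+1) − 2k log k + (k−1)log(k−1))` (`0·log 0 = 0`), the
limit of the scaled lag-`k` increment covariance `M·Cov(I_M, I_{M−k})` (THEOREM p409581;
`c_1/2 = −log 2`, `c_k/2 ∼ −1/(2k)`). [folklore] -/
def pivotLagCoeff (k : ℕ) : ℝ :=
  -(((k : ℝ) + 1) * Real.log ((k : ℝ) + 1) - 2 * ((k : ℝ) * Real.log k)
    + ((k : ℝ) - 1) * Real.log ((k : ℝ) - 1)) / 2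

/-- `S_K := Σ_{k=1}^{K} (c_k/2)²`, the `K`-node floor constant (PIVOT-LAW §15.3: `S_1 = (log 2)² =
0.480453`, `S_2 = 0.548900`, `S_3 = 0.577766`, `S_12 = 0.629356`, `S_∞ = V/2 = 0.6493591`). [folklore] -/
def pivotDeficitFloorSum (K : ℕ) : ℝ :=
  ∑ k ∈ Finset.Icc 1 K, pivotLagCoeff k ^ 2

/-- `c_1/2 = −log 2`. [folklore] -/
theorem pivotLagCoeff_one : pivotLagCoeff 1 = -Real.log 2 := by
  simp only [pivotLagCoeff, Nat.cast_one, one_add_one_eq_two, sub_self, Real.log_one, mul_zero,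
    zero_mul, add_zero, sub_zero]
  ring

/-- `S_1 = (log 2)²` (the two-node gain of PIVOT-LAW §2a(iv)). [folklore] -/
theorem pivotDeficitFloorSum_one : pivotDeficitFloorSum 1 = Real.log 2 ^ 2 := by
  rw [pivotDeficitFloorSum, Finset.Icc_self, Finset.sum_singleton, pivotLagCoeff_one, neg_sq]

/-- `S_K` is nondecreasing in `K`. [folklore] -/
theorem pivotDeficitFloorSum_mono {K K' : ℕ} (h : K ≤ K') :
    pivotDeficitFloorSum K ≤ pivotDeficitFloorSum K' :=
  Finset.sum_le_sum_of_subset_of_nonneg (Finset.Icc_subset_Icc_right h) fun _ _ _ => sq_nonneg _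

/-- The `K`-NODE FLOOR of the pivot deficit (PIVOT-LAW §15.3; DERIVED for every `K`, RH-FREE given
`S_{M−1} ≻ 0`): for every `ε > 0`, eventually in `M`,
`S_{M−1} ≻ 0 → S_K − ε ≤ G(M)·log M`, `G(M) = M·(2Ψ(log(M/(M−1))) − d_M)`. [folklore] -/
def PivotDeficitFloor (K : ℕ) : Prop :=
  ∀ ε : ℝ, 0 < ε → ∀ᶠ M : ℕ in Filter.atTop, (screwMatrix (M - 2)).PosDef →
    pivotDeficitFloorSum K - ε ≤
      (M : ℝ) * (2 * zetaScrew (Real.log ((M : ℝ) / ((M : ℝ) - 1))) - screwPivot M) * Real.log M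

/-- The floors are nested: a floor with more nodes implies the floor with fewer. [folklore] -/
theorem pivotDeficitFloor_mono {K K' : ℕ} (h : K ≤ K') (hK' : PivotDeficitFloor K') :
    PivotDeficitFloor K := fun ε hε =>
  (hK' ε hε).mono fun _ hM hPD => (sub_le_sub_right (pivotDeficitFloorSum_mono h) ε).trans (hM hPD)

/-- LEAF (P2-e): the lag-`k` increment covariance limits `M·Cov(I_M, I_{M−k}) → c_k/2` for every
`k ≥ 1` (mixed second difference of `Ψ` over the lag cell).  RH-FREE; THEOREM
(`IntegerScrewIncrementCovLag.tendsto_incrementCovLag`, p409581; `_holds` appended once its olean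
exists). [folklore] -/
@[conjecture] def PivotIncrementCovLag : Prop :=
  ∀ k : ℕ, 1 ≤ k → Filter.Tendsto (fun M : ℕ => (M : ℝ) *
      (zetaScrew (Real.log ((M : ℝ) / ((M : ℝ) - (k + 1))))
        + zetaScrew (Real.log (((M : ℝ) - 1) / ((M : ℝ) - k)))
        - zetaScrew (Real.log ((M : ℝ) / ((M : ℝ) - k)))
        - zetaScrew (Real.log (((M : ℝ) - 1) / ((M : ℝ) - (k + 1))))))
    Filter.atTop (nhds (pivotLagCoeff k))

/-- LEAF (P2-f): the TWO-NODE FLOOR `liminf G(M)·log M ≥ (log 2)²` along `S_{M−1} ≻ 0` (`K = 1`).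
RH-FREE; THEOREM in the staged `IntegerScrewDeficitLowerBound` (`eventually_deficit_mul_log_ge`,
from p406172 + p404587 + p371654; `_holds` appended once those oleans exist). [folklore] -/
@[conjecture] def PivotDeficitTwoNodeFloor : Prop := PivotDeficitFloor 1

/-- LEAF (P2-g): the CONTINUUM FLOOR `liminf G(M)·log M ≥ S_K` for EVERY `K` along `S_{M−1} ≻ 0`,
hence `≥ S_∞ = V/2 = 0.6493591` (PIVOT-LAW §15.3–15.4; DERIVED; kernel = the `K`-node trial identity on
top of p409581 — not yet written).  RH-FREE. [folklore] -/
@[conjecture] def PivotDeficitContinuumFloor : Prop := ∀ K : ℕ, PivotDeficitFloor K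

/-- The continuum floor contains the two-node floor. [folklore] -/
theorem pivotDeficitTwoNodeFloor_of_continuumFloor (h : PivotDeficitContinuumFloor) :
    PivotDeficitTwoNodeFloor := h 1

/-- `PivotIncrementCovLag` holds (`IntegerScrewIncrementCovLag.tendsto_incrementCovLag`, p409581;
appended once that module's olean existed). [folklore] -/
theorem pivotIncrementCovLag_holds : PivotIncrementCovLag := fun k hk =>
  tendsto_incrementCovLag k hk

/-- `ScrewHingeJump` holds (`IntegerScrewHingeCarrier.derivWithin_zetaScrew_Ici_sub_Iic`, p402803;
appended once that module's olean existed). [folklore] -/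
theorem screwHingeJump_holds : ScrewHingeJump := fun _ hq => derivWithin_zetaScrew_Ici_sub_Iic hq

/-- `PivotDeficitContinuumFloor` holds: the `K`-node continuum floor for EVERY `K`
(`IntegerScrewArithmeticFloor.eventually_kNode_deficit_floor'`, the case `P = ∅` of the arithmetic floor;
also `IntegerScrewKNodeFloor.eventually_kNode_deficit_floor`).  Leaf P2-g CLOSED. [folklore] -/
theorem pivotDeficitContinuumFloor_holds : PivotDeficitContinuumFloor := fun K ε hε =>
  eventually_kNode_deficit_floor' K ε hε

/-- `PivotDeficitTwoNodeFloor` holds (the case `K = 1`: `liminf G·log M ≥ (log 2)²`).  Leaf P2-f CLOSED.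
[folklore] -/
theorem pivotDeficitTwoNodeFloor_holds : PivotDeficitTwoNodeFloor :=
  pivotDeficitTwoNodeFloor_of_continuumFloor pivotDeficitContinuumFloor_holds

/-- `H_P := Σ_{q ∈ P} Λ(q)²/q²`, the hinge-floor constant of a finite set `P` of integers (only prime powers
contribute; over all prime powers `H₂ = Σ_q Λ(q)²/q² = 0.80521`, PIVOT-LAW §15.14). [folklore] -/
def pivotHingeFloorSum (P : Finset ℕ) : ℝ :=
  ∑ n ∈ P, (ArithmeticFunction.vonMangoldt n) ^ 2 / (n : ℝ) ^ 2

/-- `H_∅ = 0`. [folklore] -/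
theorem pivotHingeFloorSum_empty : pivotHingeFloorSum ∅ = 0 := by
  simp [pivotHingeFloorSum]

/-- `H_P ≥ 0`. [folklore] -/
theorem pivotHingeFloorSum_nonneg (P : Finset ℕ) : 0 ≤ pivotHingeFloorSum P :=
  Finset.sum_nonneg fun _ _ => by positivity

/-- LEAF (P2-h): the ARITHMETIC FLOOR of the pivot deficit (PIVOT-LAW §15.14): for `K : ℕ` and a finite
set `P` of integers `≥ 2`, for every `ε > 0`, eventually in `M`,
`S_{M−1} ≻ 0 → S_K + H_P − ε ≤ G(M)·log M` — the neighbour directions and the hinge carriers `⌈M/q⌉`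
are orthogonal to leading order, so their gains add (`liminf G·log M ≥ V/2 + H₂ = 1.45457` in the limit).
RH-FREE; THEOREM (`IntegerScrewArithmeticFloor.eventually_arithmetic_deficit_floor`). [folklore] -/
def PivotDeficitArithmeticFloor (K : ℕ) (P : Finset ℕ) : Prop :=
  ∀ ε : ℝ, 0 < ε → ∀ᶠ M : ℕ in Filter.atTop, (screwMatrix (M - 2)).PosDef →
    pivotDeficitFloorSum K + pivotHingeFloorSum P - ε ≤
      (M : ℝ) * (2 * zetaScrew (Real.log ((M : ℝ) / ((M : ℝ) - 1))) - screwPivot M) * Real.log M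

/-- `PivotDeficitArithmeticFloor K P` holds for every `K` and every finite set `P` of integers `≥ 2`
(`IntegerScrewArithmeticFloor.eventually_arithmetic_deficit_floor`).  Leaf P2-h CLOSED. [folklore] -/
theorem pivotDeficitArithmeticFloor_holds (K : ℕ) (P : Finset ℕ) (hP : ∀ n ∈ P, 2 ≤ n) :
    PivotDeficitArithmeticFloor K P := fun ε hε =>
  eventually_arithmetic_deficit_floor K P hP ε hε

/-- The arithmetic floor with `P = ∅` is the `K`-node floor. [folklore] -/
theorem pivotDeficitFloor_of_arithmeticFloor_empty {K : ℕ} (h : PivotDeficitArithmeticFloor K ∅) :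
    PivotDeficitFloor K := fun ε hε => by
  have h' := h ε hε
  simp only [pivotHingeFloorSum_empty, add_zero] at h'
  exact h'

end Summit.RiemannHypothesis.RiemannHypothesis.Theorems.IntegerScrew
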